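import Mathlib
import HarnessLib
import Summits.NavierStokesRegularity.NavierStokesRegularity.Theorems.PoloidalWindowDoorLrcModEntireJetCertGauge
import Summits.NavierStokesRegularity.NavierStokesRegularity.Theorems.PoloidalWindowDoorLrcModEntireTHCertSteady

/-!
# Route `PoloidalWindowDoor`, item `LrcModEntire` (stmt-NavierStokesRegularity-20428) — the (TH) local datum WITH THE GALILEAN GAUGE as point-zero letters,
# and the registered stub `stub_localTHEmptyHypNUG` from a GAUGED certificate, BY NAME

Cell ns-regularity-ideate, seat ns-poloidal-K2-p3 gen 8 (LEAD of item 20428; `--supports stmt-NavierStokesRegularity-20428`).  The registered statement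
(twist_split v4.2) carries the rest frame `u p₀.1 p₀.2 = 0`; every engine uses it (`w₀₀ = f₁₀ = f₀₁ = 0`).  With `…JetCertGauge`:

* `thLocalDatumZ` — from the hypotheses of `stub_localTHEmptyHypNUG` (the sign `μ(p₀) < 0` is not needed): a `LocalDatumZ` over the Cartesian letters with
  laws `thHyps L`, pins `thPins L ++ [pinNonUmbilic L]` and point-zero letters `[u₂, u₀, u₁]` (indices of `W 2 0 0 0 0`, `W 0 0 0 0 0`, `W 1 0 0 0 0` in `L`);
* `thZ_false_of_leaf` — the gauged leaf after chunk folding (`LocalDatumZ.extendS`);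
* `localTHEmptyHypNUG_of_leafZ` — **THE REGISTERED v4.2 STATEMENT, hypothesis for hypothesis, from one gauged Cartesian leaf certificate** (no chunks; with
  chunks use the two lemmas above).  Slice-letter version: relabel with `…JetCertGauge.LocalDatumZ.relabel` (next file of the lane).

WHAT THIS IS NOT: not a claim about Navier–Stokes and not a certificate — plumbing. [folklore]
-/

noncomputable section

-- the summit and its single sub-problem share the name (CONVENTIONS §1), as in every Theorems file
set_option linter.dupNamespace false

namespace Summit.NavierStokesRegularity.NavierStokesRegularity.Theorems.PoloidalWindowDoorLrcModEntireTHCertGauge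

open _root_.Topology _root_.Filter Set Function
open scoped InnerProductSpace Laplacian
open Literature.Analysis.ValidatedNumerics
open Summit.NavierStokesRegularity.NavierStokesRegularity.Theorems.PoloidalWindowDoorLrcModEntireJetCertDefs
open Summit.NavierStokesRegularity.NavierStokesRegularity.Theorems.PoloidalWindowDoorLrcModEntireJetCertTree
open Summit.NavierStokesRegularity.NavierStokesRegularity.Theorems.PoloidalWindowDoorLrcModEntireJetCertFast2
open Summit.NavierStokesRegularity.NavierStokesRegularity.Theorems.PoloidalWindowDoorLrcModEntireJetCertGauge
open Summit.NavierStokesRegularity.NavierStokesRegularity.Theorems.PoloidalWindowDoorLrcModEntireJetLetters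
open Summit.NavierStokesRegularity.NavierStokesRegularity.Theorems.PoloidalWindowDoorLrcModEntireTHCertLetters
open Summit.NavierStokesRegularity.NavierStokesRegularity.Theorems.PoloidalWindowDoorLrcModEntireTHCertDictionary
open Summit.NavierStokesRegularity.NavierStokesRegularity.Theorems.PoloidalWindowDoorLrcModEntireTHCert
open Summit.NavierStokesRegularity.NavierStokesRegularity.Theorems.PoloidalWindowDoorLrcModEntireTHCertSteady

/-- The point-zero letters of the Galilean gauge: the indices of `u₂, u₀, u₁` (letters `W i 0 0 0 0`) in `L`. [folklore] -/
def gaugeZeros (L : List THLetter) : List ℕ := [L.idxOf (THLetter.W 2 0 0 0 0), L.idxOf (THLetter.W 0 0 0 0 0), L.idxOf (THLetter.W 1 0 0 0 0)]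

/-- **The (TH) local datum with the non-umbilic pin and the Galilean gauge as point-zero letters**, from the hypotheses of the registered stub
`stub_localTHEmptyHypNUG` (twist_split v4.2). [folklore] -/
theorem thLocalDatumZ (L : List THLetter) (hL : lettersOK L = true)
    {u : ℝ → EuclideanSpace ℝ (Fin 3) → EuclideanSpace ℝ (Fin 3)} {μ A : ℝ → ℝ → ℝ}
    {U : Set (ℝ × EuclideanSpace ℝ (Fin 3))} {p₀ : ℝ × EuclideanSpace ℝ (Fin 3)} (hU : IsOpen U) (hp₀ : p₀ ∈ U)
    (hu : AnalyticOnNhd ℝ (Function.uncurry u) U)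
    (hμ : ∀ p ∈ U, AnalyticAt ℝ (Function.uncurry μ) (p.1, p.2 2)) (hA : ∀ p ∈ U, AnalyticAt ℝ (Function.uncurry A) (p.1, p.2 2))
    (hpol : ∀ p ∈ U, fderiv ℝ (u p.1) p.2 (EuclideanSpace.single 0 1) 1 = fderiv ℝ (u p.1) p.2 (EuclideanSpace.single 1 1) 0)
    (hdiv : ∀ p ∈ U, fderiv ℝ (u p.1) p.2 (EuclideanSpace.single 0 1) 0 + fderiv ℝ (u p.1) p.2 (EuclideanSpace.single 1 1) 1 +
      fderiv ℝ (u p.1) p.2 (EuclideanSpace.single 2 1) 2 = 0)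
    (hsh : ∀ p ∈ U, ∀ b : Fin 3, b ≠ 2 →
      fderiv ℝ (u p.1) p.2 (EuclideanSpace.single 2 1) b = μ p.1 (p.2 2) * fderiv ℝ (u p.1) p.2 (EuclideanSpace.single b 1) 2)
    (hE : ∀ p ∈ U,
      (1 - μ p.1 (p.2 2)) *
          (deriv (fun s => u s p.2 2) p.1 + fderiv ℝ (fun y => u p.1 y 2) p.2 (u p.1 p.2) - Δ (fun y => u p.1 y 2) p.2) =
        A p.1 (p.2 2) + (deriv (fun s => μ s (p.2 2)) p.1 - deriv (deriv (μ p.1)) (p.2 2)) * u p.1 p.2 2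
          + deriv (μ p.1) (p.2 2) / 2 * u p.1 p.2 2 ^ 2 - 2 * deriv (μ p.1) (p.2 2) * fderiv ℝ (u p.1) p.2 (EuclideanSpace.single 2 1) 2)
    (htw : fderiv ℝ (fun y => fderiv ℝ (u p₀.1) y (EuclideanSpace.single 2 1) 2) p₀.2 (EuclideanSpace.single 0 1) *
            fderiv ℝ (u p₀.1) p₀.2 (EuclideanSpace.single 1 1) 2 -
          fderiv ℝ (fun y => fderiv ℝ (u p₀.1) y (EuclideanSpace.single 2 1) 2) p₀.2 (EuclideanSpace.single 1 1) *
            fderiv ℝ (u p₀.1) p₀.2 (EuclideanSpace.single 0 1) 2 ≠ 0)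
    (hm0 : μ p₀.1 (p₀.2 2) ≠ 0) (hm1 : μ p₀.1 (p₀.2 2) ≠ 1) (hmz : deriv (μ p₀.1) (p₀.2 2) ≠ 0)
    (hNU : fderiv ℝ (u p₀.1) p₀.2 (EuclideanSpace.single 0 1) 0 ≠ fderiv ℝ (u p₀.1) p₀.2 (EuclideanSpace.single 1 1) 1 ∨
      fderiv ℝ (u p₀.1) p₀.2 (EuclideanSpace.single 1 1) 0 ≠ 0)
    (hrest : u p₀.1 p₀.2 = 0) :
    LocalDatumZ (E := ℝ × EuclideanSpace ℝ (Fin 3)) L.length (tableOf L) (maskOf L) dirVec (thHyps L) (thPins L ++ [pinNonUmbilic L]) (gaugeZeros L) := by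
  have m := fun ℓ (h : ℓ ∈ baseLetters) => mem_of_lettersOK hL h
  refine ⟨U, p₀, jetMapOf L u μ A, hU, hp₀, fun _ hp => differentiableAt_jetMapOf hu hμ hA hp,
    fun j i hi _ hp => tables_jetMapOf hU hu hμ hA j i hi hp, thHyps_vanish hL hU hu hμ hpol hdiv hsh hE, ?_, ?_⟩
  · intro π hπ
    rcases List.mem_append.1 hπ with h | h
    · exact thPins_ne_zero hL hU hu hμ hp₀ htw hm0 hm1 hmz π h
    · simp only [List.mem_cons, List.mem_nil_iff, or_false] at h
      subst h
      exact pinNonUmbilic_ne_zero hL hu hp₀ hNU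
  · intro i hi hlt
    simp only [gaugeZeros, List.mem_cons, List.mem_nil_iff, or_false] at hi
    have key : ∀ c : Fin 3, i = L.idxOf (THLetter.W c 0 0 0 0) → jetMapOf L u μ A p₀ ⟨i, hlt⟩ = 0 := by
      intro c hc
      have hmem : THLetter.W c 0 0 0 0 ∈ L := m _ (by fin_cases c <;> simp [baseLetters])
      have hget : L[i]'hlt = THLetter.W c 0 0 0 0 := by subst hc; exact List.getElem_idxOf (List.idxOf_lt_length_iff.2 hmem)
      rw [jetMapOf, mkJet_apply]
      show letterFn u μ A (L[(⟨i, hlt⟩ : Fin L.length)]) p₀ = 0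
      rw [show L[(⟨i, hlt⟩ : Fin L.length)] = L[i]'hlt from rfl, hget, letterFn_W0, hrest]
      rfl
    rcases hi with h | h | h
    · exact key 2 h
    · exact key 0 h
    · exact key 1 h

/-- A gauged leaf against the chunk-extended laws `thHyps L ++ Ts` closes the goal. [folklore] -/
theorem thZ_false_of_leaf (L : List THLetter) (Ts : List QMvPoly) (steps : List (List (QMvPoly × ℕ × List ℕ))) (k : ℕ) (e : List ℕ)
    (hcheck : leafCheckZ L.length (tableOf L) (maskOf L) (thHyps L ++ Ts) (thPins L ++ [pinNonUmbilic L]) (gaugeZeros L) steps k e = true)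
    (hdat : LocalDatumZ (E := ℝ × EuclideanSpace ℝ (Fin 3)) L.length (tableOf L) (maskOf L) dirVec (thHyps L ++ Ts)
      (thPins L ++ [pinNonUmbilic L]) (gaugeZeros L)) : False :=
  LocalDatumZ.false_of_leaf hdat hcheck

/-- **THE REGISTERED STUB `stub_localTHEmptyHypNUG` (twist_split v4.2, VERBATIM) FROM ONE GAUGED CARTESIAN LEAF CERTIFICATE** (no chunks):
the derivation `steps` from the five base laws produces as law `k` a polynomial that equals `twist^e₀·μ^e₁·(μ−1)^e₂·μ_z^e₃·Π_NU^e₄` up to terms containing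
`u₂(p₀)`, `u₀(p₀)` or `u₁(p₀)`. [folklore] -/
theorem localTHEmptyHypNUG_of_leafZ (L : List THLetter) (hL : lettersOK L = true) (steps : List (List (QMvPoly × ℕ × List ℕ))) (k : ℕ) (e : List ℕ)
    (hcheck : leafCheckZ L.length (tableOf L) (maskOf L) (thHyps L) (thPins L ++ [pinNonUmbilic L]) (gaugeZeros L) steps k e = true) :
    ∀ (u : ℝ → EuclideanSpace ℝ (Fin 3) → EuclideanSpace ℝ (Fin 3)) (μ A : ℝ → ℝ → ℝ)
      (U : Set (ℝ × EuclideanSpace ℝ (Fin 3))) (p₀ : ℝ × EuclideanSpace ℝ (Fin 3)),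
      IsOpen U → p₀ ∈ U →
      AnalyticOnNhd ℝ (Function.uncurry u) U →
      (∀ p ∈ U, AnalyticAt ℝ (Function.uncurry μ) (p.1, p.2 2)) →
      (∀ p ∈ U, AnalyticAt ℝ (Function.uncurry A) (p.1, p.2 2)) →
      (∀ p ∈ U, fderiv ℝ (u p.1) p.2 (EuclideanSpace.single 0 1) 1 = fderiv ℝ (u p.1) p.2 (EuclideanSpace.single 1 1) 0) →
      (∀ p ∈ U, fderiv ℝ (u p.1) p.2 (EuclideanSpace.single 0 1) 0 + fderiv ℝ (u p.1) p.2 (EuclideanSpace.single 1 1) 1 +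
        fderiv ℝ (u p.1) p.2 (EuclideanSpace.single 2 1) 2 = 0) →
      (∀ p ∈ U, ∀ b : Fin 3, b ≠ 2 →
        fderiv ℝ (u p.1) p.2 (EuclideanSpace.single 2 1) b =
          μ p.1 (p.2 2) * fderiv ℝ (u p.1) p.2 (EuclideanSpace.single b 1) 2) →
      (∀ p ∈ U,
        (1 - μ p.1 (p.2 2)) *
            (deriv (fun s => u s p.2 2) p.1 + fderiv ℝ (fun y => u p.1 y 2) p.2 (u p.1 p.2)
              - Δ (fun y => u p.1 y 2) p.2) =
          A p.1 (p.2 2) + (deriv (fun s => μ s (p.2 2)) p.1 - deriv (deriv (μ p.1)) (p.2 2)) * u p.1 p.2 2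
            + deriv (μ p.1) (p.2 2) / 2 * u p.1 p.2 2 ^ 2
            - 2 * deriv (μ p.1) (p.2 2) * fderiv ℝ (u p.1) p.2 (EuclideanSpace.single 2 1) 2) →
      fderiv ℝ (fun y => fderiv ℝ (u p₀.1) y (EuclideanSpace.single 2 1) 2) p₀.2 (EuclideanSpace.single 0 1) *
            fderiv ℝ (u p₀.1) p₀.2 (EuclideanSpace.single 1 1) 2 -
          fderiv ℝ (fun y => fderiv ℝ (u p₀.1) y (EuclideanSpace.single 2 1) 2) p₀.2 (EuclideanSpace.single 1 1) *
            fderiv ℝ (u p₀.1) p₀.2 (EuclideanSpace.single 0 1) 2 ≠ 0 →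
      μ p₀.1 (p₀.2 2) ≠ 0 → μ p₀.1 (p₀.2 2) ≠ 1 → deriv (μ p₀.1) (p₀.2 2) ≠ 0 →
      μ p₀.1 (p₀.2 2) < 0 →
      (fderiv ℝ (u p₀.1) p₀.2 (EuclideanSpace.single 0 1) 0 ≠ fderiv ℝ (u p₀.1) p₀.2 (EuclideanSpace.single 1 1) 1 ∨
        fderiv ℝ (u p₀.1) p₀.2 (EuclideanSpace.single 1 1) 0 ≠ 0) →
      u p₀.1 p₀.2 = 0 → False := by
  intro u μ A U p₀ hU hp₀ hu hμ hA hpol hdiv hsh hE htw hm0 hm1 hmz _hneg hNU hrest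
  exact LocalDatumZ.false_of_leaf (thLocalDatumZ L hL hU hp₀ hu hμ hA hpol hdiv hsh hE htw hm0 hm1 hmz hNU hrest) hcheck

end Summit.NavierStokesRegularity.NavierStokesRegularity.Theorems.PoloidalWindowDoorLrcModEntireTHCertGauge

end
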